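import Mathlib
import Literature.Analysis.FluidPDE.Tao2016AveragedNS.ShiftSetCascadeFlows
import Summits.NavierStokesRegularity.NavierStokesRegularity.Theorems.TaoLadderRungTwoFlatMirrorTableDefs
import Summits.NavierStokesRegularity.NavierStokesRegularity.Theorems.TaoLadderRungTwoFlatPulseDefs
import Summits.NavierStokesRegularity.NavierStokesRegularity.Theorems.TaoLadderRungTwoFlatPulseSymmetry
import Summits.NavierStokesRegularity.NavierStokesRegularity.Theorems.TaoLadderRungTwoFlatCaptureDefs
import HarnessLib

/-!
# The λ₀ = 1 layer of K_A♭, sharpened for the split: one-hop species-uniform contraction (S2♯) and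
  capture with headroom (S3♯) (route-posited predicates for item stmt-NavierStokesRegularity-22987
  `FlatGapCertificatesV2`, crux K_A♭ of route TaoLadderRungTwoFlat; cell harvest/h2-tao-ladder,
  theory-1 g35 — TREE-READY TEXT FOR p1 TO LAND (`--supports 22987 --as helper`); the planner does not propose)

The two-layer split `FlatGapCertificatesV2 ⇐ MirrorSolitaryWave → GradedAdiabaticWake → FlatGapCertificatesV2`
(route file TWO-LAYER PLAN; LADDER §46.13, §47) needs its children stated over TREE declarations. p1 g19 typed
the λ₀ = 1 layer (`MirrorPulse.IsPulse`, `IsRSymmetricTraj`, `LinearisedHopContraction`, `IsDatumSol`,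
`CapturedBy`, bundle `MirrorWaveAt`). Two clauses of that bundle are too weak to feed an ε₀-uniform TRANSFER
into the certificate format (`GapData₂On shiftSetFlat`), for format reasons recorded in the docstrings below:

* `OneHopContraction ε τ Φ` — (S2♯): `LinearisedHopContraction` with `N = 1` and a species-uniform gauge
  `ω : ℤ → ℝ` (the format's `ballDesc Z w r` is a one-step, species-uniform weighted sup-ball, and one-hop
  contraction is not invariant under bounded gauge changes); implies (S2) (`oneHopContraction_linearised`);
* `CapturedWithHeadroom ε Φ X₀ i₀` — (S3♯): capture in ∃-form with the HEADROOM clause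
  `(1+η)|X₀ i₀| ≤ |X i₀ n (s n)|` at every checkpoint `n ≥ 1` and bounded checkpoint gaps (the format's step
  floor `(1+ε₀)^{-θ₀} ≤ a`, `(1+σ)a ≤ |S i₀ 1 τ₁|` is absolute in anchor-normalised units — `datumState`
  divides by `|X₀ i₀|` — so the captured pulse's observable peak must beat the anchor STRICTLY: a number of the
  model, `1.8896` for x0E3 and `0.851` for the bare datum (float), which no analysis supplies; hence the
  clause belongs to the certified side);
* `datumE3` — the charged datum `(1, 2)` over `ℝ` (the `ℚ` copy is `CertificateGlueScalarsE3On.x0E3`).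

HONEST FRAMING: DEFINITIONS (predicates; nothing asserted about `mirrorTable ½ ½`) and one elementary
implication about a MODEL lattice (Tao 2016 §4 vocabulary, `S♭`); nothing certified; nothing about the
Navier–Stokes equations.
-/

noncomputable section

-- the sub-problem namespace repeats the summit name by design (D-0017)
set_option linter.dupNamespace false

namespace Summit.NavierStokesRegularity.NavierStokesRegularity.Theorems

open Set Filter Literature.Analysis.FluidPDE Literature.Analysis.FluidPDE.TaoCascade
open scoped Topology

namespace MirrorPulse

/-- The CHARGED one-shell datum `x0E3 = (1, 2)` (carrier `1`, bond `2`) over `ℝ`.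
[cite: Tao2016AveragedNS, §4 (4.7) (one-shell datum); route TaoLadderRungTwoFlat, posited object] -/
def datumE3 : Fin 2 → ℝ := fun i => if i = 0 then 1 else 2

/-- The carrier component of the charged datum is the anchor `1 ≠ 0`.
[cite: Tao2016AveragedNS, §4 (4.7); route TaoLadderRungTwoFlat] -/
theorem datumE3_zero : datumE3 0 = 1 := by simp [datumE3]

/-- **(S2♯) ONE-HOP LINEARISED CONTRACTION in a species-uniform two-sided gauge**: there are weights
`ω k > 0`, a factor `0 ≤ ρ < 1` and a constant `C` such that every bounded solution `u` of the variational
equation along the pulse on `[0, τ]` with `sup ω_k |u_{i,k}(0)| ≤ B` satisfies, after ONE hop and in the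
co-moving frame, `ω_k |u_{i,k+1}(τ) − c₁ Q(Φ)_{i,k+1}(τ) − c₂ Φ_{i,k+1}(τ)| ≤ ρ B` for some `|c₁|, |c₂| ≤ C B`
(phase and scale directions quotiented). `LinearisedHopContraction` with `N = 1`, `ω i k = ω k`. A predicate;
nothing asserted. [cite: Tao2016AveragedNS, §6.3–6.4 Props. 6.4–6.5 (statement shape); route TaoLadderRungTwoFlat, posited object, λ₀ = 1 layer (S2♯)] -/
def OneHopContraction (ε τ : ℝ) (Φ : Fin 2 → ℤ → ℝ → ℝ) : Prop :=
  ∃ (ω : ℤ → ℝ) (ρ C : ℝ), (∀ k, 0 < ω k) ∧ 0 ≤ ρ ∧ ρ < 1 ∧ 0 ≤ C ∧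
    ∀ (u : Fin 2 → ℤ → ℝ → ℝ) (B : ℝ), IsVariationalOn ε τ Φ u →
      (∀ (i : Fin 2) (k : ℤ), ω k * |u i k 0| ≤ B) →
        ∃ c₁ c₂ : ℝ, |c₁| ≤ C * B ∧ |c₂| ≤ C * B ∧
          ∀ (i : Fin 2) (k : ℤ),
            ω k * |u i (k + 1) τ
              - c₁ * quadTermOn shiftSetFlat 0 (mirrorTable ε ε) Φ i (k + 1) τ
              - c₂ * Φ i (k + 1) τ| ≤ ρ * B

/-- **(S3♯) CAPTURE WITH HEADROOM** of the one-shell datum `X₀` (observable species `i₀`) by the pulse `Φ`: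
the datum solution `X`, a scale `κ > 0`, a headroom `η > 0`, a gap bound `c` and checkpoint times
`0 = s 0 < s 1 < …`, `s (n+1) ≤ s n + c`, with (headroom) `(1+η)·|X₀ i₀| ≤ |X i₀ n (s n)|` for every `n ≥ 1`
and (capture) co-moving window convergence at the checkpoints to the phase-`0` state of `κΦ(κ·)` on every
finite window. A predicate; nothing asserted.
[cite: Tao2016AveragedNS, §6.2 Prop. 6.3 (checkpoint description, statement shape); route TaoLadderRungTwoFlat, posited object, λ₀ = 1 layer (S3♯)] -/
def CapturedWithHeadroom (ε : ℝ) (Φ : Fin 2 → ℤ → ℝ → ℝ) (X₀ : Fin 2 → ℝ) (i₀ : Fin 2) : Prop :=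
  ∃ (X : Fin 2 → ℤ → ℝ → ℝ) (κ η c : ℝ) (s : ℕ → ℝ), IsDatumSol ε X₀ X ∧ 0 < κ ∧ 0 < η ∧
    StrictMono s ∧ s 0 = 0 ∧ (∀ n : ℕ, s (n + 1) ≤ s n + c) ∧
    (∀ n : ℕ, 1 ≤ n → (1 + η) * |X₀ i₀| ≤ |X i₀ (n : ℤ) (s n)|) ∧
    ∀ (K : ℕ) (δ : ℝ), 0 < δ → ∃ N₀ : ℕ, ∀ N : ℕ, N₀ ≤ N →
      ∀ (i : Fin 2) (k : ℤ), |k| ≤ K → |X i ((N : ℤ) + k) (s N) - κ * Φ i k 0| ≤ δ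

/-- (S2♯) implies (S2): `OneHopContraction ε τ Φ → LinearisedHopContraction ε τ Φ` (`N := 1`, `ω i k := ω k`).
[cite: Tao2016AveragedNS, §6.3–6.4 (statement shape); route TaoLadderRungTwoFlat, λ₀ = 1 layer] -/
theorem oneHopContraction_linearised {ε τ : ℝ} {Φ : Fin 2 → ℤ → ℝ → ℝ}
    (h : OneHopContraction ε τ Φ) : LinearisedHopContraction ε τ Φ := by
  obtain ⟨ω, ρ, C, hω, hρ0, hρ1, hC, hstep⟩ := h
  refine ⟨fun _ k => ω k, ρ, C, 1, fun _ k => hω k, hρ0, hρ1, hC, le_rfl, ?_⟩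
  intro u B hu hB
  have hu' : IsVariationalOn ε τ Φ u := by simpa using hu
  obtain ⟨c₁, c₂, h1, h2, h3⟩ := hstep u B hu' hB
  refine ⟨c₁, c₂, h1, h2, fun i k => ?_⟩
  simpa using h3 i k

/-- The headroom clause at the first checkpoint: a captured datum's observable beats its anchor strictly at
shell `1` — in particular `X₀ i₀`'s anchor is exceeded, which the bare datum `(1,0)` of `T♭(½)` cannot do
(float `0.851`; the clause is what separates the two data). [cite: Tao2016AveragedNS, §6.2 (statement shape); route TaoLadderRungTwoFlat, λ₀ = 1 layer] -/
theorem CapturedWithHeadroom.anchor_lt {ε : ℝ} {Φ : Fin 2 → ℤ → ℝ → ℝ} {X₀ : Fin 2 → ℝ} {i₀ : Fin 2}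
    (h : CapturedWithHeadroom ε Φ X₀ i₀) (hX₀ : X₀ i₀ ≠ 0) :
    ∃ (X : Fin 2 → ℤ → ℝ → ℝ) (t : ℝ), IsDatumSol ε X₀ X ∧ 0 < t ∧ |X₀ i₀| < |X i₀ 1 t| := by
  obtain ⟨X, κ, η, c, s, hX, hκ, hη, hs, hs0, -, hhead, -⟩ := h
  refine ⟨X, s 1, hX, ?_, ?_⟩
  · have := hs (show (0 : ℕ) < 1 by norm_num); rwa [hs0] at this
  · have h1 := hhead 1 le_rfl
    have hpos : 0 < |X₀ i₀| := abs_pos.mpr hX₀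
    have : |X₀ i₀| < (1 + η) * |X₀ i₀| := by nlinarith
    simpa using this.trans_le h1

end MirrorPulse

end Summit.NavierStokesRegularity.NavierStokesRegularity.Theorems

end
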